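import Literature.MathematicalPhysics.QuantumFieldTheory.Balaban1983to89.B9Eq326LocalPartDivergenceRow
import Literature.MathematicalPhysics.QuantumFieldTheory.Balaban1983to89.B9Eq342GreenPrimeTowerGradientRow

/-!
# `Balaban1983to89.B9Eq326LocalPartTowerSliceGradientRow` — T. Bałaban, *Propagators for lattice gauge theories in a background field*, Commun. Math. Phys.
# **99** (1985) 389–434 [Balaban1985BackgroundPropagators] Thm 3.1 (3.42) p. 397 SECOND ENTRY *«|(∇_U Gλ)(x)| ≤ B₀e^{−δ₀d(y,y′)}|λ|, x ∈ Δ(y), supp λ ⊂ Δ(y′)»*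
# read for the LOCAL PART `A₀ = Δ(U) + D_UD*_U + Q*aQ` of (3.26) p. 395 in its GENUINE (vector) form — (3.3) p. 391 applied to each component `A_ν` of a bond
# field, [Balaban1985Variational] (115) p. 294 `|∇·|_{(−2)}`, (117) p. 295 —, with (3.23) p. 394, (3.49) p. 399, (3.69)–(3.73) pp. 404–405, [Balaban1985Variational]
# (134)–(136) p. 298: **THE COVARIANT (SLICE) GRADIENT ROW OF THE TOWER LOCAL PART — for `A₀,k = Δ(U) + D_UD*_U + Q_k(U)†(a•Q_k(U))` on the bonds of the
# tower's fine torus `T_{(L^{n+1}m)}`, a source `f` supported over the bonds of ONE unit block `v` with `‖f(b)‖ ≤ F`, EVERY fine bond `b` and EVERY component `ν`: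
# `‖(∇_U A₀,k⁻¹f)(b, ν)‖ = ‖(D_U (A₀,k⁻¹f)_ν)(b)‖ ≤ 2e^{θ(L^{n+1}−1)}·(A + B·C_u)·B_{b.2}·F·e^{−κ·d_m(Πb₊, v)}` given the decayed value row
# `‖(A₀,k⁻¹f)(b)‖ ≤ C_u·F·e^{−κ·d_m(Πb₋, v)}` (DISPLAYED; supplied by ne9-leaf-03's (EA0S)∕(ECL)), `A = 2|η⁻¹|`, `B = 2(|η⁻¹|((c_P + m_c) + dη⁻²(b′ + b²)) + |η⁻¹|b∕β)`,
# `b = 2M_φM_φ′ε_t`, `b′ = 2M_φM_φ′a_U`, `c_P` the constant of ne9-leaf-03's `B9Eq326LocalPartTowerZerothOrderCoshRow` at `κ := η⁻²`** — the GRADIENT member of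
# [Balaban1985Variational] (117) for `𝔊̃_k` (print: *«By Theorem 3.13 of [5] the norm max{|·|_{(−1)}, |∇·|_{(−2)}} of the transformation can be estimated by
# B₀|J|_{(−3)} + …»*), whose finite-lattice substitute `B11Eq117TransformationNorm.norm_nabla115_le` (`‖∇A‖_∞ ≤ 2|η|⁻¹‖A‖_∞`) costs the height `|η|⁻¹ = L^{n+1}`;
# the sibling of ne9-leaf-03's (DVT) `B9Eq326LocalPartTowerDivergenceRow` (the divergence row = the VALUE member's `D*_UG₁,k`) and of this lineage's (GT)
# `B9Eq342GreenPrimeTowerGradientRow` (the site propagator `G′_k`); NE9 owner INTENT-1 gen 96, journal [NE9P1-G96-INTENT-1]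

statement-level skeleton of published theorems with citation tags; proofs where landed; nothing here is a claim about the Yang–Mills mass gap

CITATION HEADER (lean-in-tree rule).  Audit cell `pub-balaban`, sub-cell `t4`, BINDER row NE9; filed by the NE9 BINDER-row OWNER lineage `b2b-balaban-t4-ne9-p1`
(gen 96).  Imports ne9-leaf-05's (K48) `B9Eq326LocalPartDivergenceRow` (storey J on a generic torus `TSite d N` for a solution of `L_K u + P u = f`: §1 there,
`norm_covDerivL2K_slice_le_weighted`, IS the slice-gradient row with the contraction binder `hθ` displayed; its t-free closing exists for the divergence only —
§0 below supplies it for the slice), this lineage's (GT) `B9Eq342GreenPrimeTowerGradientRow` (§0: the tower's big-block currency; through it (K54)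
`B9Eq342GradientRowSmallGaugeLetters`, `B9Eq342CoshWeightSite`).  SOURCE READ first-hand in the held text layer [Balaban1985BackgroundPropagators]
(`paper:balaban1985-cmp99-background-propagators`, journal page = PDF page + 388): p. 391 (3.3) *«(∇^η_U A)(b, c) = η⁻¹(R(U(b))A(c) − A(b))»* read per component
(p. 391: *«A(x, x + ηe_μ) = A_μ(x)»*); p. 397 Thm 3.1 (3.42); p. 395 (3.26); p. 394 (3.23); p. 399 (3.49); pp. 404–405 (3.69)–(3.73); p. 426 Thm 3.13;
[Balaban1985Variational] p. 294 (115), p. 295 (117), p. 298 (134)–(136).  Print proves the gradient rows by the random walk of Sect. 3 pp. 398–409 over the cubes of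
(3.35); the cell's road is storey J (a weighted sup-norm contraction; t4-ne9-idea-1, ne9-leaf-05 (K41)) on top of ne9-leaf-03's Kato-domination value row of
`A₀,k⁻¹` — [folklore] composition BY NAME of tree theorems; NOTHING of print's proof is reproduced; nothing printed is a hypothesis except the model letters;
the `[cite: …]` tags are TEXT LOCATIONS.

WHAT IS PROVED (sorry-free; proof lane — 0 `def`; [folklore]).
* §0 **`norm_covDerivL2K_slice_le_weighted_uniform`** — (K48) §1's t-FREE closing on a generic torus: with a rate `a ≤ κ`, `|t|B_ν ≤ C ≤ K∕√m` and ONE mass choice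
  `2(c∕r + |t|b)(e^{κ}+1)dK ≤ √m` the contraction binder holds with `θ ≤ ½` ((K38) `theta_le`∕`theta_le_half`) and `‖(D_U u_μ)(b)‖ ≤ 2ρ₀·(B_{b.2}·W_{x₀}(b₊))` —
  the five lines of (K48) §3 on the slice instead of the divergence.
* §1 **`norm_covDerivL2K_slice_le_bigBlockLetter_smallGauge`** — storey J's slice-gradient row AT THE TOWER, generic order-zero part `P`, small-gauge model:
  §0 at `N := towerP L m (n+1)`, centre `x₀ := b₊`, comparison gauge `g ≡ 1` and cutoff `χ ≡ 1` ((K54) `inner_AdW_one`, `norm_sub_pureGauge_le`, `norm_rel_sub_le`,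
  `norm_inv_sub_le`, `norm_covDiff_le`; `c∕r = c∕r² = 0`, `Ω = univ`), the data ∕ value rows in (GT) §0's big-block currency per component
  (`weighted_row_of_bigBlock_support`, `weighted_row_of_bigBlock_decay`), the `hPuv` slot displayed, `W_{b₊}(b₊) = 1` (`weight_site_centre`) — the SAME binder list
  as ne9-leaf-03's (DVT) §1, output at a bond and a component instead of a site.
* §3 **`covGrad_apply_eq_slice`** — the READING: `B9Eq33CovDerivVector.covGrad c R (u read on the bonds) (b, ν)` IS `(covDerivL2K c R u_ν)(b)` (`rfl`-level:
  `covGrad_eq_covDeriv_comp`, `equiv_covDerivL2K`), so `B11Eq111FrakG.nabla115 η U₀ = covGrad η⁻¹ (Ad U₀)` takes the rows above BY NAME.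
HONEST SCOPE.  Composition BY NAME; DISPLAYED: the decayed value row (`C_u`, `κ ≤ θL^{n+1}` — (EA0S) `B9Eq326LocalPartTowerSupDecay.norm_localInvK_apply_le_decay`
∕ (ECL) supply it, not composed here), (T) contractions, the big-block family `P_y`, the MODEL letters (`U(b) ∈ U1`, `‖U(b) − 1‖ ≤ ε_t`, the bond-gradient datum
`a_U`, the plaquette letters `δ`, the `Q_k` regularity letters, the diagonal `c₀(L^{n+1})^d = c₁`), storey J's windows (`θ`, `m_c`, `β`, `κ′`, `C`, `K`); every
constant symbolic and crude; the tower-specific letters `e^{θ(L^{n+1}−1)}`, `e^{θd(2L^{n+1}−1)}`, `√(c₀·d·(L^{n+1})^d)∕√c₁`, `|η⁻¹|ε_t`, `η⁻²a_U`, `|η⁻¹|B_ν`,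
`|η⁻¹|b∕β` are displayed as they fall — height-free at `θ = κ₀η`, `ε_t = αη`, `a_U = α′η²`, `β := 2 sinh θ∕(m_c − 2dη⁻²(cosh θ − 1))` on print's diagonal
`ηL^{n+1} = 1` exactly as this lineage's (GTD) `B9Eq342GreenPrimeTowerGradientRowDiagonal` reads the site twin (the companion closing, not here); the rows of
`G₁,k` itself (Woodbury, `∇_UG₁,k = ∇_UA₀,k⁻¹ + ∇_UA₀,k⁻¹(C*z)`) are NOT here; nothing of [B9] Thm 3.1∕3.3∕3.11∕3.13 is asserted, valued or discharged.
NOT NE9 (cell pub-balaban: NE9 NOT PRINTED ∕ NOT PROVED; «NE9 ⇐ the named binders»; row WALLED ON A MODEL (O-NE9-1; #5 UNRULED); spine PROVED 0∕9; rung (B)+1 on a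
finite T⁴ — NOT infinite volume, NOT mass gap, NOT BetaPertH, NOT Clay; HONEST DEPENDENCY: continuum YM on T⁴ ⇐ BetaPertH ∧ nine spine estimates (0/9 proved);
BetaPertH ⇐ (D1) ∧ (D4) ∧ CAP+tail; G-an2-4 gates asym, D1 and NE2/3/4).  NEW file; nothing modified.  Net new unproved facts: 0.
-/

noncomputable section

set_option autoImplicit false

open scoped BigOperators InnerProductSpace

namespace Literature.MathematicalPhysics.QuantumFieldTheory.Balaban1983to89.B9Eq326LocalPartTowerSliceGradientRow

open B4Sect5Torus (TSite tdist)
open B4TorusKernel.MultiPeriod (circAbs)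
open B9SectCLatticeCarrier (Bond DirPair bpos btgt shift unshift)
open B9Eq311L2Pairing (WL2)
open B9Eq33CovDerivVector (covGrad covGrad_eq_covDeriv_comp)
open B11Eq103H1Complex (SiteL2K BondL2K covDivL2K covDerivL2K greenK apply_greenK equiv_covDerivL2K)
open B9Eq310HessianOperator (adTransportW curvOp hessOp)
open B9Eq310DeltaPrime (reHol imHol)
open B7Prop1Explicit (U1 Wcx boxVec)
open B9Eq319QprimeTorus (fineP blockCoord)
open B9Eq315QTorus (perCfg cornerSite)
open B9Eq315QTower (towerP UlevOf)
open B9Eq316TowerFlatIsOneStep (towerP_eq_fineP_pow siteCast)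
open B9Eq326OperatorTower (QkW)
open B9Eq328GaugeAction (gaugeU AdW)
open B9Eq326LocalPartKatoForm (bondLapK weitzOpK localPart_eq_kato_add)
open B9Eq326LocalPartDivergenceRow (norm_covDerivL2K_slice_le_weighted)
open B9Eq331PureGaugeResolventConjugation (adTransportW_inv_adTransportW)
open B9Eq342GradientRowAssembly (div_one_sub_le_two_mul)
open B9Eq342GradientRowNaturalPerturbation (weight_site_pos theta_le theta_le_half)
open B9Eq342GradientRowSmallGaugeLetters (inner_AdW_one norm_sub_pureGauge_le norm_rel_sub_le norm_inv_sub_le norm_covDiff_le)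
open B9Eq342CoshWeightSite (weight_site_centre)
open B9Eq342GreenPrimeTowerGradientRow (weighted_row_of_bigBlock_decay weighted_row_of_bigBlock_support)

/-! ## §0 The slice-gradient row of (K48), t-free closing (generic torus) -/

section Uniform

variable {d : ℕ} {N : Fin d → ℕ} [∀ μ, NeZero (N μ)] {𝔸 : Type*} [Ring 𝔸] [Algebra ℂ 𝔸] {V : Type*} [NormedAddCommGroup V] [InnerProductSpace ℂ V]
  [FiniteDimensional ℂ V] (φ : V ≃ₗ[ℂ] 𝔸) {c₁ : ℝ} [Fact (0 < c₁)] (t m a : ℝ) (hm : 0 < m) (x₀ : TSite d N) (gf : Bond d N → TSite d N → 𝔸ˣ)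
  (hAdf : ∀ (b₀ : Bond d N) (x : TSite d N) (v v' : V), ⟪AdW φ (gf b₀ x) v, AdW φ (gf b₀ x) v'⟫_ℂ = ⟪v, v'⟫_ℂ)

include hAdf hm in
/-- **THE SLICE-GRADIENT ROW, t-FREE CLOSING** (the `_uniform` reading of `B9Eq342GradientRowAssembly` §4 on (K48) §1, the slice twin of (K48) §3
`norm_covDivL2K_le_weighted_uniform`): in the setting of `B9Eq326LocalPartDivergenceRow.norm_covDerivL2K_slice_le_weighted` (`L_K u + P u = f` on the bonds of
`TSite d N` with weighted rows `Γ` (data), `N_P` (order-zero part), `N_u` (value) on the site weight `W_{x₀}`; cutoffs, comparison gauges, fibre letters `δ, b, b′`,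
currency `0 < β ≤ B_ν`), with a rate `a ≤ κ`, the per-direction letter `|t|·B_ν ≤ C ≤ K∕√m` and ONE mass choice `2·(c∕r + |t|b)·(e^{κ} + 1)·d·K ≤ √m` the
contraction binder holds with `θ ≤ 1∕2` ((K38) `theta_le` ∕ `theta_le_half`), and for every component `μ` and every bond `b`:
`‖(D_U u_μ)(b)‖ ≤ 2ρ₀·(B_{b.2}·W_{x₀}(b₊))`, `ρ₀ = |t|((Γ + (N_P + ‖m‖N_u)) + ε₂N_u) + (|t|δ∕β)N_u` — no denominator, no `hθ`. [folklore]
[cite: Balaban1985BackgroundPropagators, (3.3) p.391, (3.26) p.395, Thm 3.1 (3.42) p.397] -/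
theorem norm_covDerivL2K_slice_le_weighted_uniform (ht : 0 < t) (ha : 0 ≤ a) (hlam : 2 * (d : ℝ) * t ^ 2 * (Real.cosh a - 1) < m)
    (hn : ∀ ν, 2 ≤ N ν) (R S : Bond d N → V →ₗ[ℂ] V) (hSR : ∀ b w, S b (R b w) = w) (hRc : ∀ b w, ‖R b w‖ ≤ ‖w‖) (hSc : ∀ b w, ‖S b w‖ ≤ ‖w‖)
    (P : BondL2K ℂ d N c₁ V →ₗ[ℂ] BondL2K ℂ d N c₁ V) (u f : BondL2K ℂ d N c₁ V) (hu : bondLapK ℂ c₁ (t : ℂ) R S u + P u = f)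
    {Γ NP Nu : ℝ} (hΓ : 0 ≤ Γ) (hNP : 0 ≤ NP) (hNu : 0 ≤ Nu) (hf : ∀ b : Bond d N, ‖WL2.equiv ℂ _ V f b‖ ≤ Γ * (fun y : TSite d N => ∏ μ, Real.cosh (a * (circAbs (N μ) (ZMod.val (((x₀ μ : ℕ) : ZMod (N μ)) - ((y μ : ℕ) : ZMod (N μ)))) : ℝ))) b.1)
    (hPu : ∀ b : Bond d N, ‖WL2.equiv ℂ _ V (P u) b‖ ≤ NP * (fun y : TSite d N => ∏ μ, Real.cosh (a * (circAbs (N μ) (ZMod.val (((x₀ μ : ℕ) : ZMod (N μ)) - ((y μ : ℕ) : ZMod (N μ)))) : ℝ))) b.1) (hval : ∀ b : Bond d N, ‖WL2.equiv ℂ _ V u b‖ ≤ Nu * (fun y : TSite d N => ∏ μ, Real.cosh (a * (circAbs (N μ) (ZMod.val (((x₀ μ : ℕ) : ZMod (N μ)) - ((y μ : ℕ) : ZMod (N μ)))) : ℝ))) b.1)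
    (χ : Bond d N → TSite d N → ℝ) (hχ1 : ∀ b₀ y, |χ b₀ y| ≤ 1) (hχp : ∀ b₀, χ b₀ (bpos b₀) = 1) (hχt : ∀ b₀, χ b₀ (btgt b₀) = 1)
    {c r : ℝ} (hcr : 0 ≤ c / r) (hcr2 : 0 ≤ c / r ^ 2) (h1p : ∀ b₀ x μ, |t * (χ b₀ (shift μ x) - χ b₀ x)| ≤ c / r)
    (h1m : ∀ b₀ x μ, |t * (χ b₀ x - χ b₀ (unshift μ x))| ≤ c / r) (h2 : ∀ b₀ x μ, |t ^ 2 * (2 * χ b₀ x - χ b₀ (shift μ x) - χ b₀ (unshift μ x))| ≤ c / r ^ 2)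
    (Ω : Bond d N → Set (TSite d N)) (hΩ : ∀ b₀ x, x ∉ Ω b₀ → χ b₀ x = 0 ∧ (∀ μ, χ b₀ (shift μ x) = 0) ∧ (∀ μ, χ b₀ (unshift μ x) = 0))
    {δ b b' : ℝ} (hδ0 : 0 ≤ δ) (hb : 0 ≤ b) (hb' : 0 ≤ b') (hδ : ∀ b₀ w, ‖R b₀ w - (adTransportW φ (gaugeU (gf b₀) 1) : Bond d N → V →ₗ[ℂ] V) b₀ w‖ ≤ δ * ‖w‖)
    (hBp : ∀ b₀, ∀ x ∈ Ω b₀, ∀ μ w, ‖(adTransportW φ (gaugeU (gf b₀) 1) : Bond d N → V →ₗ[ℂ] V) (x, μ) (S (x, μ) w) - w‖ ≤ b * ‖w‖)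
    (hBm : ∀ b₀, ∀ x ∈ Ω b₀, ∀ μ w, ‖(adTransportW φ (gaugeU (gf b₀) 1) : Bond d N → V →ₗ[ℂ] V) (unshift μ x, μ) (S (unshift μ x, μ) w) - w‖ ≤ b * ‖w‖)
    (hBt : ∀ b₀, ∀ x ∈ Ω b₀, ∀ μ w, ‖(adTransportW φ (fun bb => (gaugeU (gf b₀) 1 bb)⁻¹) : Bond d N → V →ₗ[ℂ] V) (unshift μ x, μ) w - S (unshift μ x, μ) w‖ ≤ b * ‖w‖)
    (hD : ∀ b₀, ∀ x ∈ Ω b₀, ∀ μ w, ‖((adTransportW φ (gaugeU (gf b₀) 1) : Bond d N → V →ₗ[ℂ] V) (x, μ) (S (x, μ) w) - w) -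
      (adTransportW φ (fun bb => (gaugeU (gf b₀) 1 bb)⁻¹) : Bond d N → V →ₗ[ℂ] V) (unshift μ x, μ) ((adTransportW φ (gaugeU (gf b₀) 1) : Bond d N → V →ₗ[ℂ] V) (unshift μ x, μ) (S (unshift μ x, μ) ((adTransportW φ (gaugeU (gf b₀) 1) : Bond d N → V →ₗ[ℂ] V) (unshift μ x, μ) w)) - (adTransportW φ (gaugeU (gf b₀) 1) : Bond d N → V →ₗ[ℂ] V) (unshift μ x, μ) w)‖ ≤ b' * ‖w‖)
    {β : ℝ} (hβ : 0 < β) (hβB : ∀ ν, β ≤ (fun ν : Fin d => (1 + Real.exp (-a)) * ((1 + 2 * t / (N ν * Real.sqrt (m - 2 * ((d : ℝ) - 1) * t ^ 2 * (Real.cosh a - 1)))) /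
      Real.sqrt ((m - 2 * ((d : ℝ) - 1) * t ^ 2 * (Real.cosh a - 1)) ^ 2 + 4 * (m - 2 * ((d : ℝ) - 1) * t ^ 2 * (Real.cosh a - 1)) * t ^ 2)) +
    2 * Real.sinh a / (m - 2 * (d : ℝ) * t ^ 2 * (Real.cosh a - 1))) ν)
    {κ C K : ℝ} (haκ : a ≤ κ) (hC : 0 ≤ C) (htB : ∀ ν, ‖(t : ℂ)‖ * (fun ν : Fin d => (1 + Real.exp (-a)) * ((1 + 2 * t / (N ν * Real.sqrt (m - 2 * ((d : ℝ) - 1) * t ^ 2 * (Real.cosh a - 1)))) /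
      Real.sqrt ((m - 2 * ((d : ℝ) - 1) * t ^ 2 * (Real.cosh a - 1)) ^ 2 + 4 * (m - 2 * ((d : ℝ) - 1) * t ^ 2 * (Real.cosh a - 1)) * t ^ 2)) +
    2 * Real.sinh a / (m - 2 * (d : ℝ) * t ^ 2 * (Real.cosh a - 1))) ν ≤ C) (hCK : C ≤ K / Real.sqrt m)
    (hmK : 2 * ((c / r + |t| * b) * (Real.exp κ + 1) * (d : ℝ) * K) ≤ Real.sqrt m) (μ : Fin d) (bnd : Bond d N) :
    ‖WL2.equiv ℂ _ V (covDerivL2K ℂ c₁ (t : ℂ) R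
        ((WL2.equiv ℂ (fun _ : TSite d N => c₁) V).symm fun y => WL2.equiv ℂ (fun _ : Bond d N => c₁) V u (y, μ))) bnd‖ ≤
      (2 * (‖(t : ℂ)‖ * ((Γ + (NP + ‖((m : ℝ) : ℂ)‖ * Nu)) +
          ((d : ℝ) * (c / r ^ 2) + |t| * b * (c / r) * ((d : ℝ) * (1 + Real.exp a)) + (d : ℝ) * (t ^ 2 * (b' + b * b))) * Nu) + |t| * δ / β * Nu)) *
        ((fun ν : Fin d => (1 + Real.exp (-a)) * ((1 + 2 * t / (N ν * Real.sqrt (m - 2 * ((d : ℝ) - 1) * t ^ 2 * (Real.cosh a - 1)))) /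
      Real.sqrt ((m - 2 * ((d : ℝ) - 1) * t ^ 2 * (Real.cosh a - 1)) ^ 2 + 4 * (m - 2 * ((d : ℝ) - 1) * t ^ 2 * (Real.cosh a - 1)) * t ^ 2)) +
    2 * Real.sinh a / (m - 2 * (d : ℝ) * t ^ 2 * (Real.cosh a - 1))) bnd.2 * (fun y : TSite d N => ∏ μ, Real.cosh (a * (circAbs (N μ) (ZMod.val (((x₀ μ : ℕ) : ZMod (N μ)) - ((y μ : ℕ) : ZMod (N μ)))) : ℝ))) (btgt bnd)) := by
  have hεn : 0 ≤ c / r + |t| * b := by positivity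
  have htB' : ∀ ν, |t| * (fun ν : Fin d => (1 + Real.exp (-a)) * ((1 + 2 * t / (N ν * Real.sqrt (m - 2 * ((d : ℝ) - 1) * t ^ 2 * (Real.cosh a - 1)))) /
      Real.sqrt ((m - 2 * ((d : ℝ) - 1) * t ^ 2 * (Real.cosh a - 1)) ^ 2 + 4 * (m - 2 * ((d : ℝ) - 1) * t ^ 2 * (Real.cosh a - 1)) * t ^ 2)) +
    2 * Real.sinh a / (m - 2 * (d : ℝ) * t ^ 2 * (Real.cosh a - 1))) ν ≤ C := fun ν => by have e := htB ν; rwa [Complex.norm_real, Real.norm_eq_abs] at e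
  have hγ : 0 ≤ Real.exp a + 1 := by positivity
  have hθle := theta_le (fun ν : Fin d => (1 + Real.exp (-a)) * ((1 + 2 * t / (N ν * Real.sqrt (m - 2 * ((d : ℝ) - 1) * t ^ 2 * (Real.cosh a - 1)))) /
      Real.sqrt ((m - 2 * ((d : ℝ) - 1) * t ^ 2 * (Real.cosh a - 1)) ^ 2 + 4 * (m - 2 * ((d : ℝ) - 1) * t ^ 2 * (Real.cosh a - 1)) * t ^ 2)) +
    2 * Real.sinh a / (m - 2 * (d : ℝ) * t ^ 2 * (Real.cosh a - 1))) hεn hγ (Real.exp_le_exp.mpr haκ) hC htB'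
  have hpos : 0 ≤ (c / r + |t| * b) * (Real.exp κ + 1) * (d : ℝ) := by positivity
  have hθhalf' := theta_le_half hθle hpos hm hCK hmK
  have hθhalf : ‖(t : ℂ)‖ * ((c / r + |t| * b) * ((Real.exp a + 1) * ∑ ν, (fun ν : Fin d => (1 + Real.exp (-a)) * ((1 + 2 * t / (N ν * Real.sqrt (m - 2 * ((d : ℝ) - 1) * t ^ 2 * (Real.cosh a - 1)))) /
      Real.sqrt ((m - 2 * ((d : ℝ) - 1) * t ^ 2 * (Real.cosh a - 1)) ^ 2 + 4 * (m - 2 * ((d : ℝ) - 1) * t ^ 2 * (Real.cosh a - 1)) * t ^ 2)) +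
    2 * Real.sinh a / (m - 2 * (d : ℝ) * t ^ 2 * (Real.cosh a - 1))) ν)) ≤ 1 / 2 := by
    rw [Complex.norm_real, Real.norm_eq_abs]; exact hθhalf'
  have hθ : ‖(t : ℂ)‖ * ((c / r + |t| * b) * ((Real.exp a + 1) * ∑ ν, (fun ν : Fin d => (1 + Real.exp (-a)) * ((1 + 2 * t / (N ν * Real.sqrt (m - 2 * ((d : ℝ) - 1) * t ^ 2 * (Real.cosh a - 1)))) /
      Real.sqrt ((m - 2 * ((d : ℝ) - 1) * t ^ 2 * (Real.cosh a - 1)) ^ 2 + 4 * (m - 2 * ((d : ℝ) - 1) * t ^ 2 * (Real.cosh a - 1)) * t ^ 2)) +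
    2 * Real.sinh a / (m - 2 * (d : ℝ) * t ^ 2 * (Real.cosh a - 1))) ν)) < 1 := hθhalf.trans_lt (by norm_num)
  have hmain := norm_covDerivL2K_slice_le_weighted φ t m a hm x₀ gf hAdf ht ha hlam hn R S hSR hRc hSc P u f hu hΓ hNP hNu hf hPu hval χ hχ1 hχp hχt hcr
    hcr2 h1p h1m h2 Ω hΩ hδ0 hb hb' hδ hBp hBm hBt hD hβ hβB hθ μ bnd
  have hBC : 0 ≤ (fun ν : Fin d => (1 + Real.exp (-a)) * ((1 + 2 * t / (N ν * Real.sqrt (m - 2 * ((d : ℝ) - 1) * t ^ 2 * (Real.cosh a - 1)))) /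
      Real.sqrt ((m - 2 * ((d : ℝ) - 1) * t ^ 2 * (Real.cosh a - 1)) ^ 2 + 4 * (m - 2 * ((d : ℝ) - 1) * t ^ 2 * (Real.cosh a - 1)) * t ^ 2)) +
    2 * Real.sinh a / (m - 2 * (d : ℝ) * t ^ 2 * (Real.cosh a - 1))) bnd.2 := hβ.le.trans (hβB bnd.2)
  have hA : 0 ≤ (‖(t : ℂ)‖ * ((Γ + (NP + ‖((m : ℝ) : ℂ)‖ * Nu)) +
          ((d : ℝ) * (c / r ^ 2) + |t| * b * (c / r) * ((d : ℝ) * (1 + Real.exp a)) + (d : ℝ) * (t ^ 2 * (b' + b * b))) * Nu) + |t| * δ / β * Nu) := by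
    positivity
  exact hmain.trans (mul_le_mul_of_nonneg_right (div_one_sub_le_two_mul hA hθhalf) (mul_nonneg hBC (weight_site_pos a x₀ (btgt bnd)).le))

end Uniform

/-! ## §1 Storey J's slice-gradient row at the tower, small-gauge model, generic order-zero part -/

section Generic

variable {d : ℕ} (L : ℕ) [NeZero L] (m : Fin d → ℕ) [∀ i, NeZero (m i)] (n : ℕ)
  {𝔸 : Type*} [NormedRing 𝔸] [NormedAlgebra ℂ 𝔸] [NormOneClass 𝔸]
  {W : Type*} [NormedAddCommGroup W] [InnerProductSpace ℂ W] [FiniteDimensional ℂ W] (φ : W ≃ₗ[ℂ] 𝔸) {Mφ Mφ' : ℝ}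
  (hφ : ∀ w, ‖φ w‖ ≤ Mφ * ‖w‖) (hφ' : ∀ X, ‖φ.symm X‖ ≤ Mφ' * ‖X‖) (hMφ : 0 ≤ Mφ) (hMφ' : 0 ≤ Mφ')
  {c₀ : ℝ} [Fact (0 < c₀)] (t mm θ : ℝ) (hmm : 0 < mm)
  (U : Bond d (towerP L m (n + 1)) → 𝔸ˣ) (hU1 : ∀ b, U b ∈ U1 𝔸) {εU aU : ℝ} (hεU : 0 ≤ εU) (haU : 0 ≤ aU)
  (hUε : ∀ b, ‖(U b : 𝔸) - 1‖ ≤ εU)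
  (hUa : ∀ (x : TSite d (towerP L m (n + 1))) (μ : Fin d), ‖(U (x, μ) : 𝔸) - (U (unshift μ x, μ) : 𝔸)‖ ≤ aU)


include hφ hφ' hMφ hMφ' hmm hU1 hεU haU hUε hUa in
/-- **STOREY J's SLICE-GRADIENT ROW AT THE TOWER, SMALL-GAUGE MODEL, GENERIC ORDER-ZERO PART** (the slice twin of ne9-leaf-03's (DVT) §1
`B9Eq326LocalPartTowerDivergenceRow.norm_covDivL2K_le_bigBlockLetter_smallGauge`; the bond-field twin of this lineage's (GT) §1).  On the bonds of
`T_{(L^{n+1}m)}`: a background with `U(b) ∈ U1`, `‖U(b) − 1‖ ≤ ε_U` and the bond-gradient datum `‖U(x,μ) − U(x−e_μ,μ)‖ ≤ a_U`; (T) contractive transporters; a bond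
equation `L_K u + P u = f` (`L_K = bondLapK t (Ad U) (Ad U⁻¹)`, `P` ANY linear map); a source `f` supported over the bonds of ONE big block `v` with `‖f(b)‖ ≤ F`;
the decayed value row `‖u(b)‖ ≤ C_u·F·e^{−κ·d_m(Πb₋, v)}` (`0 ≤ κ ≤ θL^{n+1}`); the order-zero implication `hPuv` (for every centre the value row carries to a
`P`-row with the constant `c_P`); a site rate `θ ≥ 0`, a comparison mass `m_c > 2dt²(cosh θ − 1)` and the t-free windows of (K41) §4 (`0 < β ≤ B_ν`,
`|t|B_ν ≤ C ≤ K∕√m_c`, `θ ≤ κ′`, `2(|t|·2M_φM_φ′ε_U)(e^{κ′}+1)dK ≤ √m_c`).  THEN for every component `μ` and every fine bond `b`: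
`‖(D_U u_μ)(b)‖ ≤ 2e^{θ(L^{n+1}−1)}·((2|t|) + (2(|t|((c_P + m_c) + dt²(b′ + b²)) + |t|b∕β)·C_u)·B_{b.2}·F·e^{−κ·d_m(Πb₊, v)}`, `b = 2M_φM_φ′ε_U`,
`b′ = 2M_φM_φ′a_U` — §0 at `N := towerP L m (n+1)`, centre `x₀ := b₊`, comparison gauge `g ≡ 1` and cutoff `χ ≡ 1` ((K54)), the three weighted rows by
(GT) §0 per component, `W_{b₊}(b₊) = 1`. [folklore]
[cite: Balaban1985BackgroundPropagators, Thm 3.1 (3.42) p.397, (3.3) p.391, (3.26) p.395, (3.35) p.396, (3.49) p.399, (3.70)–(3.73) pp.404–405] -/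
theorem norm_covDerivL2K_slice_le_bigBlockLetter_smallGauge (ht : 0 < t) (hθ : 0 ≤ θ) (hlam : 2 * (d : ℝ) * t ^ 2 * (Real.cosh θ - 1) < mm)
    (hn : ∀ ν, 2 ≤ towerP L m (n + 1) ν)
    (hR : ∀ (b : Bond d (towerP L m (n + 1))) (w : W), ‖adTransportW φ U b w‖ ≤ ‖w‖)
    (hS : ∀ (b : Bond d (towerP L m (n + 1))) (w : W), ‖adTransportW φ (fun bb => (U bb)⁻¹) b w‖ ≤ ‖w‖)
    (P : BondL2K ℂ d (towerP L m (n + 1)) c₀ W →ₗ[ℂ] BondL2K ℂ d (towerP L m (n + 1)) c₀ W) (u f : BondL2K ℂ d (towerP L m (n + 1)) c₀ W)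
    (hu : bondLapK ℂ c₀ (t : ℂ) (adTransportW φ U) (adTransportW φ fun bb => (U bb)⁻¹) u + P u = f)
    (v : TSite d m) {F Cu κ cP : ℝ} (hF : 0 ≤ F) (hCu : 0 ≤ Cu) (hκ : 0 ≤ κ) (hκθ : κ ≤ θ * (L : ℝ) ^ (n + 1)) (hcP : 0 ≤ cP)
    (hfv : ∀ b : Bond d (towerP L m (n + 1)), blockCoord (L ^ (n + 1)) m (siteCast (towerP_eq_fineP_pow L m (n + 1)) b.1) ≠ v → WL2.equiv ℂ (fun _ : Bond d (towerP L m (n + 1)) => c₀) W f b = 0)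
    (hfF : ∀ b : Bond d (towerP L m (n + 1)), ‖WL2.equiv ℂ (fun _ : Bond d (towerP L m (n + 1)) => c₀) W f b‖ ≤ F)
    (hudec : ∀ b : Bond d (towerP L m (n + 1)), ‖WL2.equiv ℂ (fun _ : Bond d (towerP L m (n + 1)) => c₀) W u b‖ ≤
      Cu * F * Real.exp (-(κ * tdist m (blockCoord (L ^ (n + 1)) m (siteCast (towerP_eq_fineP_pow L m (n + 1)) b.1)) v)))
    (hPuv : ∀ (y : TSite d (towerP L m (n + 1))) (Nu : ℝ), 0 ≤ Nu →
      (∀ b : Bond d (towerP L m (n + 1)), ‖WL2.equiv ℂ (fun _ : Bond d (towerP L m (n + 1)) => c₀) W u b‖ ≤ Nu *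
          (fun x : TSite d (towerP L m (n + 1)) => ∏ μ, Real.cosh (θ * (circAbs (towerP L m (n + 1) μ)
            (ZMod.val (((y μ : ℕ) : ZMod (towerP L m (n + 1) μ)) - ((x μ : ℕ) : ZMod (towerP L m (n + 1) μ)))) : ℝ))) b.1) →
      ∀ b : Bond d (towerP L m (n + 1)), ‖WL2.equiv ℂ (fun _ : Bond d (towerP L m (n + 1)) => c₀) W (P u) b‖ ≤ (cP * Nu) *
          (fun x : TSite d (towerP L m (n + 1)) => ∏ μ, Real.cosh (θ * (circAbs (towerP L m (n + 1) μ)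
            (ZMod.val (((y μ : ℕ) : ZMod (towerP L m (n + 1) μ)) - ((x μ : ℕ) : ZMod (towerP L m (n + 1) μ)))) : ℝ))) b.1)
    {β : ℝ} (hβ : 0 < β) (hβB : ∀ ν, β ≤ (fun ν : Fin d => (1 + Real.exp (-θ)) *
    ((1 + 2 * t / (towerP L m (n + 1) ν * Real.sqrt (mm - 2 * ((d : ℝ) - 1) * t ^ 2 * (Real.cosh θ - 1)))) /
      Real.sqrt ((mm - 2 * ((d : ℝ) - 1) * t ^ 2 * (Real.cosh θ - 1)) ^ 2 + 4 * (mm - 2 * ((d : ℝ) - 1) * t ^ 2 * (Real.cosh θ - 1)) * t ^ 2)) +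
    2 * Real.sinh θ / (mm - 2 * (d : ℝ) * t ^ 2 * (Real.cosh θ - 1))) ν) {κ' C K : ℝ} (hθκ : θ ≤ κ') (hC : 0 ≤ C) (htB : ∀ ν, ‖(t : ℂ)‖ * (fun ν : Fin d => (1 + Real.exp (-θ)) *
    ((1 + 2 * t / (towerP L m (n + 1) ν * Real.sqrt (mm - 2 * ((d : ℝ) - 1) * t ^ 2 * (Real.cosh θ - 1)))) /
      Real.sqrt ((mm - 2 * ((d : ℝ) - 1) * t ^ 2 * (Real.cosh θ - 1)) ^ 2 + 4 * (mm - 2 * ((d : ℝ) - 1) * t ^ 2 * (Real.cosh θ - 1)) * t ^ 2)) +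
    2 * Real.sinh θ / (mm - 2 * (d : ℝ) * t ^ 2 * (Real.cosh θ - 1))) ν ≤ C)
    (hCK : C ≤ K / Real.sqrt mm) (hmK : 2 * ((|t| * (2 * Mφ * Mφ' * εU)) * (Real.exp κ' + 1) * (d : ℝ) * K) ≤ Real.sqrt mm)
    (μ : Fin d) (bnd : Bond d (towerP L m (n + 1))) :
    ‖WL2.equiv ℂ (fun _ : Bond d (towerP L m (n + 1)) => c₀) W (covDerivL2K ℂ c₀ (t : ℂ) (adTransportW φ U) ((WL2.equiv ℂ (fun _ : TSite d (towerP L m (n + 1)) => c₀) W).symm fun y => WL2.equiv ℂ (fun _ : Bond d (towerP L m (n + 1)) => c₀) W u (y, μ))) bnd‖ ≤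
      2 * Real.exp (θ * ((L : ℝ) ^ (n + 1) - 1)) *
        ((2 * ‖(t : ℂ)‖) +
          (2 * (‖(t : ℂ)‖ * ((cP + ‖((mm : ℝ) : ℂ)‖) +
              (d : ℝ) * (t ^ 2 * (2 * Mφ * Mφ' * aU + (2 * Mφ * Mφ' * εU) * (2 * Mφ * Mφ' * εU)))) + |t| * (2 * Mφ * Mφ' * εU) / β) * Cu)) *
        (fun ν : Fin d => (1 + Real.exp (-θ)) *
    ((1 + 2 * t / (towerP L m (n + 1) ν * Real.sqrt (mm - 2 * ((d : ℝ) - 1) * t ^ 2 * (Real.cosh θ - 1)))) /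
      Real.sqrt ((mm - 2 * ((d : ℝ) - 1) * t ^ 2 * (Real.cosh θ - 1)) ^ 2 + 4 * (mm - 2 * ((d : ℝ) - 1) * t ^ 2 * (Real.cosh θ - 1)) * t ^ 2)) +
    2 * Real.sinh θ / (mm - 2 * (d : ℝ) * t ^ 2 * (Real.cosh θ - 1))) bnd.2 * F * Real.exp (-(κ * tdist m (blockCoord (L ^ (n + 1)) m (siteCast (towerP_eq_fineP_pow L m (n + 1)) (btgt bnd))) v)) := by
  -- the centre `x₀ := b₊`; the common factor `M′ = 2e^{θ(L^{n+1}−1)}` and the decay `E = e^{−κ·d_m(Πb₊, v)}`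
  have hM'0 : 0 ≤ 2 * Real.exp (θ * ((L : ℝ) ^ (n + 1) - 1)) := by positivity
  have hE0 : 0 ≤ Real.exp (-(κ * tdist m (blockCoord (L ^ (n + 1)) m (siteCast (towerP_eq_fineP_pow L m (n + 1)) (btgt bnd))) v)) := (Real.exp_pos _).le
  -- (DATA) the source row `Γ` at the centre `b₊`, per component
  have hf' : ∀ b : Bond d (towerP L m (n + 1)), ‖WL2.equiv ℂ (fun _ : Bond d (towerP L m (n + 1)) => c₀) W f b‖ ≤
      (2 * Real.exp (θ * ((L : ℝ) ^ (n + 1) - 1)) * F * Real.exp (-(κ * tdist m (blockCoord (L ^ (n + 1)) m (siteCast (towerP_eq_fineP_pow L m (n + 1)) (btgt bnd))) v))) *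
          (fun x : TSite d (towerP L m (n + 1)) => ∏ μ, Real.cosh (θ * (circAbs (towerP L m (n + 1) μ)
            (ZMod.val (((btgt bnd μ : ℕ) : ZMod (towerP L m (n + 1) μ)) - ((x μ : ℕ) : ZMod (towerP L m (n + 1) μ)))) : ℝ))) b.1 := fun b =>
    weighted_row_of_bigBlock_support L m n (fun x => WL2.equiv ℂ (fun _ : Bond d (towerP L m (n + 1)) => c₀) W f (x, b.2)) v
      hθ hF hκ hκθ (fun x hx => hfv (x, b.2) hx) (fun x => hfF (x, b.2)) (btgt bnd) b.1
  -- (VALUE) the decayed value row `N_u` at the centre `b₊`, per component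
  have hval : ∀ b : Bond d (towerP L m (n + 1)), ‖WL2.equiv ℂ (fun _ : Bond d (towerP L m (n + 1)) => c₀) W u b‖ ≤
      (2 * Real.exp (θ * ((L : ℝ) ^ (n + 1) - 1)) * (Cu * F) * Real.exp (-(κ * tdist m (blockCoord (L ^ (n + 1)) m (siteCast (towerP_eq_fineP_pow L m (n + 1)) (btgt bnd))) v))) *
          (fun x : TSite d (towerP L m (n + 1)) => ∏ μ, Real.cosh (θ * (circAbs (towerP L m (n + 1) μ)
            (ZMod.val (((btgt bnd μ : ℕ) : ZMod (towerP L m (n + 1) μ)) - ((x μ : ℕ) : ZMod (towerP L m (n + 1) μ)))) : ℝ))) b.1 := fun b =>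
    weighted_row_of_bigBlock_decay L m n (fun x => WL2.equiv ℂ (fun _ : Bond d (towerP L m (n + 1)) => c₀) W u (x, b.2)) v
      hθ (mul_nonneg hCu hF) hκ hκθ (fun x => hudec (x, b.2)) (btgt bnd) b.1
  have hΓ : 0 ≤ 2 * Real.exp (θ * ((L : ℝ) ^ (n + 1) - 1)) * F * Real.exp (-(κ * tdist m (blockCoord (L ^ (n + 1)) m (siteCast (towerP_eq_fineP_pow L m (n + 1)) (btgt bnd))) v)) := by positivity
  have hNu : 0 ≤ 2 * Real.exp (θ * ((L : ℝ) ^ (n + 1) - 1)) * (Cu * F) * Real.exp (-(κ * tdist m (blockCoord (L ^ (n + 1)) m (siteCast (towerP_eq_fineP_pow L m (n + 1)) (btgt bnd))) v)) := by positivity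
  -- (ORDER ZERO) the `P`-row at the centre `b₊`
  have hPu := hPuv (btgt bnd) _ hNu hval
  -- §0 at the tower, comparison gauge `≡ 1`, cutoff `≡ 1`
  have hb0 : 0 ≤ 2 * Mφ * Mφ' * εU := by positivity
  have hb'0 : 0 ≤ 2 * Mφ * Mφ' * aU := by positivity
  have hmK' : 2 * ((((0 : ℝ) / 1 + |t| * (2 * Mφ * Mφ' * εU)) * (Real.exp κ' + 1) * (d : ℝ)) * K) ≤ Real.sqrt mm := by
    rw [zero_div, zero_add]; simpa only [mul_assoc] using hmK
  have hmain := norm_covDerivL2K_slice_le_weighted_uniform φ t mm θ hmm (btgt bnd)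
    (fun _ : Bond d (towerP L m (n + 1)) => (1 : TSite d (towerP L m (n + 1)) → 𝔸ˣ)) (fun _ x w w' => inner_AdW_one φ x w w')
    ht hθ hlam hn (adTransportW φ U) (adTransportW φ fun bb => (U bb)⁻¹) (fun b w => adTransportW_inv_adTransportW φ U b w) hR hS
    P u f hu hΓ (mul_nonneg hcP hNu) hNu hf' hPu hval
    (fun (_ : Bond d (towerP L m (n + 1))) (_ : TSite d (towerP L m (n + 1))) => (1 : ℝ)) (fun _ _ => by simp) (fun _ => rfl) (fun _ => rfl)
    (c := 0) (r := 1) (by norm_num) (by norm_num) (fun _ _ _ => by simp) (fun _ _ _ => by simp) (fun _ _ _ => by norm_num)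
    (fun _ : Bond d (towerP L m (n + 1)) => (Set.univ : Set (TSite d (towerP L m (n + 1)))))
    (fun _ x hx => absurd (Set.mem_univ x) hx)
    hb0 hb0 hb'0 (fun b₀ w => norm_sub_pureGauge_le φ hφ hφ' hMφ' U hU1 hUε b₀ w)
    (fun _ x _ μ w => norm_rel_sub_le φ hφ hφ' hMφ' U hU1 hUε (x, μ) w)
    (fun _ x _ μ w => norm_rel_sub_le φ hφ hφ' hMφ' U hU1 hUε (unshift μ x, μ) w)
    (fun _ x _ μ w => norm_inv_sub_le φ hφ hφ' hMφ' U hU1 hUε (unshift μ x, μ) w)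
    (fun _ x _ μ w => norm_covDiff_le φ hφ hφ' hMφ hMφ' U hU1 hUa x μ w) hβ hβB hθκ hC htB hCK hmK' μ bnd
  -- read the output: `W_{b₊}(b₊) = 1`, the zero cutoff letters vanish
  have hcentre :
      (fun x : TSite d (towerP L m (n + 1)) => ∏ μ, Real.cosh (θ * (circAbs (towerP L m (n + 1) μ)
            (ZMod.val (((btgt bnd μ : ℕ) : ZMod (towerP L m (n + 1) μ)) - ((x μ : ℕ) : ZMod (towerP L m (n + 1) μ)))) : ℝ))) (btgt bnd) = 1 := weight_site_centre (towerP L m (n + 1)) θ (btgt bnd)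
  rw [hcentre, mul_one] at hmain
  refine hmain.trans (le_of_eq ?_)
  simp only [zero_div, mul_zero, zero_mul, zero_add, add_zero]
  ring

end Generic

/-! ## §3 The reading: the covariant gradient (3.3) of a bond field IS the slice derivative -/

section Reading

variable {d : ℕ} {N : Fin d → ℕ} {W : Type*} [NormedAddCommGroup W] [InnerProductSpace ℂ W] {c₀ : ℝ} [Fact (0 < c₀)]

/-- **`(∇_U u)(b, ν) = (D_U u_ν)(b)`** — `B9Eq33CovDerivVector.covGrad c R` of the bond field `u` read on the bonds, at `(b, ν)`, is the `L²`-carrier covariant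
derivative `covDerivL2K c R` of the ν-slice `u_ν` read at `b` (`covGrad_eq_covDeriv_comp`, `equiv_covDerivL2K`: both `rfl`).  Hence the letter
`B11Eq111FrakG.nabla115 η U₀ = covGrad η⁻¹ (Ad U₀)` of the space (115) takes §1∕§2 BY NAME. [folklore]
[cite: Balaban1985BackgroundPropagators, (3.3) p.391; Balaban1985Variational, (115) p.294, (117) p.295] -/
theorem covGrad_apply_eq_slice (c : ℂ) (R : Bond d N → W →ₗ[ℂ] W) (u : BondL2K ℂ d N c₀ W) (bnd : Bond d N) (ν : Fin d) :
    covGrad c R (WL2.equiv ℂ (fun _ : Bond d N => c₀) W u) (bnd, ν) =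
      WL2.equiv ℂ (fun _ : Bond d N => c₀) W (covDerivL2K ℂ c₀ c R
        ((WL2.equiv ℂ (fun _ : TSite d N => c₀) W).symm fun y => WL2.equiv ℂ (fun _ : Bond d N => c₀) W u (y, ν))) bnd := by
  rw [equiv_covDerivL2K, covGrad_eq_covDeriv_comp]
  rfl

/-- **The norm form of the reading**: any bound on the slice derivative at `(μ, b)` is a bound on `‖(∇_U u)(b, μ)‖`. [folklore]
[cite: Balaban1985BackgroundPropagators, (3.3) p.391; Balaban1985Variational, (117) p.295] -/
theorem norm_covGrad_apply_le_of_slice (c : ℂ) (R : Bond d N → W →ₗ[ℂ] W) (u : BondL2K ℂ d N c₀ W) (bnd : Bond d N) (ν : Fin d) {B : ℝ}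
    (h : ‖WL2.equiv ℂ (fun _ : Bond d N => c₀) W (covDerivL2K ℂ c₀ c R
        ((WL2.equiv ℂ (fun _ : TSite d N => c₀) W).symm fun y => WL2.equiv ℂ (fun _ : Bond d N => c₀) W u (y, ν))) bnd‖ ≤ B) :
    ‖covGrad c R (WL2.equiv ℂ (fun _ : Bond d N => c₀) W u) (bnd, ν)‖ ≤ B := by
  rw [covGrad_apply_eq_slice]; exact h

end Reading

end Literature.MathematicalPhysics.QuantumFieldTheory.Balaban1983to89.B9Eq326LocalPartTowerSliceGradientRow

end
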